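import Literature.MathematicalPhysics.QuantumFieldTheory.ConformalBootstrap3D.PointCertificateTable

/-!
# Rule (M) on the twist-gap domain `E - j ≥ τ` (architecture B″, pub-ising3d REFEREE F58)

Every `z`-series term `(n, j)` of a block `g_{Δ,ℓ}` (Hogervorst–Rychkov 2013, §3: levels `E = Δ + n`,
spins `|j - ℓ| ≤ n`) has "twist" `E - j = Δ + n - j ≥ Δ - ℓ`. In the single-correlator `σ–ε`
system every block that a strip certificate meets has `Δ - ℓ ≥ 1` — spinning blocks by the
unitarity bound `Δ ≥ ℓ + 1`, scalars because `Δ ≥ Δ_ε ≥ 1`, `Δ ≥ 3` or `Δ ≥ E₀ ≥ 1` — so the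
termwise rule (M) of the point-functional certificate is only ever USED on the domain `E - j ≥ 1`,
whereas `boxExcluded_of_pointRules` / `boxExcluded_of_pointTable` ask for it on `E - j ≥ 1/2`
(the weakest twist above the scalar unitarity bound). The production verifier (`verify_points`
1.1, `c = 1` when `ε_lo ≥ 1`) certifies (M) on `j ≤ E - 1` only (REFEREE F58: sound on paper, but
not an instance of the Lean hypothesis as typed).

This file re-proves the (M)-consuming chain with a TWIST-GAP PARAMETER `τ`: rule (M) is asked on
`E ∈ [E₀, E_T)`, `j + τ ≤ E`, under the side conditions `τ ≤ 1` (spinning blocks sit at twist `≥ 1`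
only) and `τ ≤ E₀` (scalar tail blocks have `Δ ≥ E₀`); head cells start at `a ≥ ℓ + 1 ≥ ℓ + τ`
anyway. `τ = 1` is the verifier's domain, `τ = 1/2` recovers the landed statements (with the
vacuous extra condition `1/2 ≤ E₀`):
`tail_blockPositive_of_termwise_and_apex_twist`, `tail_nonneg_pointFunctional_of_termwise_and_apex_twist`,
`boxExcluded_of_pointRules_twist` (the schema), `headSum/headCell/headChord_pointFunctional_of_pointRules_twist`,
`cell_of_headNumber_twist`, `ruleM_of_boxTable_twist` (box rows for `j + τ < E_T` from
`≤ max(E₀, j + τ)`), `boxExcluded_of_pointTable_twist` (the finite table). Term basis: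
Hogervorst–Rychkov 2013, §3 eq. (3.6). [cite: HogervorstRychkov2013, §3 eq. (3.6)]
-/

noncomputable section

namespace Literature.MathematicalPhysics.QuantumFieldTheory.ConformalBootstrap3D

open Finset Set Filter Topology

/-! ### The tail with rule (M) on `E - j ≥ τ` -/

/-- Every block strictly above the unitarity bound with `Δ ≥ E₀ ≥ τ`, `τ ≤ 1`, has `Δ ≥ ℓ + τ`
(`ℓ = 0`: `Δ ≥ E₀ ≥ τ`; `ℓ ≥ 1`: `Δ > ℓ + 1 ≥ ℓ + τ`). [folklore] -/
theorem natCast_add_le_of_unitarityBound3D_lt {ℓ : ℕ} {Δ τ E₀ : ℝ} (hτ1 : τ ≤ 1) (hτ0 : τ ≤ E₀)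
    (hΔ : unitarityBound3D ℓ < Δ) (hΔ0 : E₀ ≤ Δ) : (ℓ : ℝ) + τ ≤ Δ := by
  by_cases h : ℓ = 0
  · subst h; simp only [Nat.cast_zero, zero_add]; exact hτ0.trans hΔ0
  · have hb : unitarityBound3D ℓ = (ℓ : ℝ) + 1 := by simp [unitarityBound3D, h]
    rw [hb] at hΔ
    linarith

/-- **Split tail at a regular point, twist-gap domain.** Termwise positivity of `Φ(E, j, s)` for
`E ∈ [E₀, E_T)`, `j + τ ≤ E` (rule (M) on the twist-gap domain, `τ ≤ 1`, `τ ≤ E₀`) together with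
the apex inequality at `E_T` (rule (T)) gives `BlockPositive φ s Δ ℓ` for every spin and every
regular `Δ ≥ E₀` above the unitarity bound: the terms `(n, j)` of the block have
`j + τ ≤ ℓ + n + τ ≤ Δ + n = E`. [cite: HogervorstRychkov2013, §3 eq. (3.6)] -/
theorem tail_blockPositive_of_termwise_and_apex_twist {N : ℕ} (w z zb : Fin N → ℝ)
    (hz : ∀ k, z k ∈ Ioo (0 : ℝ) 1) (hzb : ∀ k, zb k ∈ Ioo (0 : ℝ) 1) (hord : ∀ k, zb k ≤ z k)
    (a : Fin N) (qd qr : Fin N → ℝ) (hqd : ∀ k, 0 < qd k ∧ qd k ≤ 1)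
    (hqr : ∀ k, 0 < qr k ∧ qr k ≤ 1)
    (hdomd : ∀ k, z k * zb k ≤ qd k ^ 2 * (z a * zb a) ∧ z k ≤ qd k * z a)
    (hdomr : ∀ k, (1 - z k) * (1 - zb k) ≤ qr k ^ 2 * (z a * zb a) ∧ 1 - zb k ≤ qr k * z a)
    {s E₀ ET τ : ℝ} (hτ1 : τ ≤ 1) (hτ0 : τ ≤ E₀)
    (hM : ∀ (j : ℕ) (E : ℝ), E₀ ≤ E → E < ET → (j : ℝ) + τ ≤ E →
      0 ≤ pointFunctional w z zb (crossF s (-1) (zMono E j)))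
    (hB : ∑ k ∈ univ.erase a, |w k| * ((1 - z k) * (1 - zb k)) ^ s * qd k ^ ET
          + ∑ k, |w k| * (z k * zb k) ^ s * qr k ^ ET ≤ w a * ((1 - z a) * (1 - zb a)) ^ s)
    {Δ : ℝ} {ℓ : ℕ} (hΔ : unitarityBound3D ℓ < Δ) (hreg : ¬ accidentalDegeneracy3D Δ ℓ)
    (hΔ0 : E₀ ≤ Δ) :
    BlockPositive (pointFunctional w z zb) s Δ ℓ := by
  refine blockPositive_pointFunctional_of_forall w z zb hz hzb hΔ hreg fun q hq => ?_
  have hℓτ : (ℓ : ℝ) + τ ≤ Δ := natCast_add_le_of_unitarityBound3D_lt hτ1 hτ0 hΔ hΔ0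
  have h1 : (q.2 : ℝ) ≤ (ℓ : ℝ) + (q.1 : ℝ) := by exact_mod_cast hq.2.1
  have hjE : (q.2 : ℝ) + τ ≤ Δ + (q.1 : ℝ) := by linarith
  have hjE' : (q.2 : ℝ) ≤ Δ + (q.1 : ℝ) := by
    linarith [natCast_add_half_le_unitarityBound3D ℓ]
  have hE0 : E₀ ≤ Δ + (q.1 : ℝ) := hΔ0.trans (le_add_of_nonneg_right (Nat.cast_nonneg _))
  by_cases hlt : Δ + (q.1 : ℝ) < ET
  · exact hM q.2 (Δ + (q.1 : ℝ)) hE0 hlt hjE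
  · exact term_nonneg_of_apex w z zb hz hzb hord a qd qr hqd hqr hdomd hdomr hB hjE' (not_lt.1 hlt)

/-- **Obligation (O5) with a split tail, twist-gap domain, on a box.** As
`tail_nonneg_pointFunctional_of_termwise_and_apex` with rule (M) asked only for `j + τ ≤ E`
(`τ ≤ 1`, `τ ≤ E₀`): `BlockPositive φ s Δ ℓ` for every `(s, ·) ∈ Q`, every spin `ℓ`, every
`Δ ≥ E₀` with `unitarityBound3D ℓ ≤ Δ` (non-regular points by the limit clause).
[cite: HogervorstRychkov2013, §3 eq. (3.6)] -/
theorem tail_nonneg_pointFunctional_of_termwise_and_apex_twist {N : ℕ} (w z zb : Fin N → ℝ)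
    (hz : ∀ k, z k ∈ Ioo (0 : ℝ) 1) (hzb : ∀ k, zb k ∈ Ioo (0 : ℝ) 1) (hord : ∀ k, zb k ≤ z k)
    (a : Fin N) (ha : 0 ≤ w a) (qd qr : Fin N → ℝ) (hqd : ∀ k, 0 < qd k ∧ qd k ≤ 1)
    (hqr : ∀ k, 0 < qr k ∧ qr k ≤ 1)
    (hdomd : ∀ k, z k * zb k ≤ qd k ^ 2 * (z a * zb a) ∧ z k ≤ qd k * z a)
    (hdomr : ∀ k, (1 - z k) * (1 - zb k) ≤ qr k ^ 2 * (z a * zb a) ∧ 1 - zb k ≤ qr k * z a)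
    {Q : Set (ℝ × ℝ)} {slo shi E₀ ET τ : ℝ} (hQ : ∀ p ∈ Q, slo ≤ p.1 ∧ p.1 ≤ shi)
    (hτ1 : τ ≤ 1) (hτ0 : τ ≤ E₀)
    (hM : ∀ (j : ℕ) (E : ℝ), E₀ ≤ E → E < ET → (j : ℝ) + τ ≤ E → ∀ p ∈ Q,
      0 ≤ pointFunctional w z zb (crossF p.1 (-1) (zMono E j)))
    (hB : ∑ k ∈ univ.erase a, |w k| * ((1 - z k) * (1 - zb k)) ^ slo * qd k ^ ET
          + ∑ k, |w k| * (z k * zb k) ^ slo * qr k ^ ET ≤ w a * ((1 - z a) * (1 - zb a)) ^ shi) :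
    ∀ p ∈ Q, ∀ ℓ : ℕ, ∀ Δ : ℝ, unitarityBound3D ℓ ≤ Δ → E₀ ≤ Δ →
      BlockPositive (pointFunctional w z zb) p.1 Δ ℓ := by
  intro p hp ℓ Δ hbd hΔ0
  have hBs := apexIneq_of_box w z zb hz hzb a ha qd qr (fun k => (hqd k).1.le)
    (fun k => (hqr k).1.le) (hQ p hp) hB
  have hMs : ∀ (j : ℕ) (E : ℝ), E₀ ≤ E → E < ET → (j : ℝ) + τ ≤ E →
      0 ≤ pointFunctional w z zb (crossF p.1 (-1) (zMono E j)) :=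
    fun j E h1 h2 h3 => hM j E h1 h2 h3 p hp
  by_cases hregpt : IsRegularPoint3D Δ ℓ
  · exact tail_blockPositive_of_termwise_and_apex_twist w z zb hz hzb hord a qd qr hqd hqr hdomd
      hdomr hτ1 hτ0 hMs hBs (lt_of_le_of_ne hbd (Ne.symm hregpt.1)) hregpt.2 hΔ0
  · refine blockPositive_of_eventually_right w z zb hz hzb p.1 Δ ℓ hregpt ?_
    filter_upwards [eventually_isRegularPoint3D_nhdsGT_of_bound_le hbd, self_mem_nhdsWithin]
      with Δ' hΔ' hgt
    have hgt' : Δ < Δ' := Set.mem_Ioi.1 hgt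
    exact ⟨hΔ', tail_blockPositive_of_termwise_and_apex_twist w z zb hz hzb hord a qd qr hqd hqr
      hdomd hdomr hτ1 hτ0 hMs hBs (lt_of_le_of_lt hbd hgt') hΔ'.2 (hΔ0.trans hgt'.le)⟩

/-- **The point-functional certificate schema, twist-gap domain.** As `boxExcluded_of_pointRules`
with rule (M) asked only on `E ∈ [E₀, E_T)`, `j + τ ≤ E`, under `τ ≤ 1`, `τ ≤ E₀` (`τ = 1`: the
domain `j ≤ E - 1` of `verify_points` 1.1, pub-ising3d REFEREE F58).
[cite: HogervorstRychkov2013, §3 eq. (3.6)] -/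
theorem boxExcluded_of_pointRules_twist {N : ℕ} {w z zb : Fin N → ℝ}
    (hz : ∀ k, z k ∈ Ioo (0 : ℝ) 1) (hzb : ∀ k, zb k ∈ Ioo (0 : ℝ) 1) (hord : ∀ k, zb k ≤ z k)
    (a : Fin N) (ha : 0 ≤ w a) (qd qr : Fin N → ℝ) (hqd : ∀ k, 0 < qd k ∧ qd k ≤ 1)
    (hqr : ∀ k, 0 < qr k ∧ qr k ≤ 1)
    (hdomd : ∀ k, z k * zb k ≤ qd k ^ 2 * (z a * zb a) ∧ z k ≤ qd k * z a)
    (hdomr : ∀ k, (1 - z k) * (1 - zb k) ≤ qr k ^ 2 * (z a * zb a) ∧ 1 - zb k ≤ qr k * z a)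
    {Q : Set (ℝ × ℝ)} {slo shi E₀ ET τ : ℝ} (hQ : ∀ p ∈ Q, slo ≤ p.1 ∧ p.1 ≤ shi)
    (hτ1 : τ ≤ 1) (hτ0 : τ ≤ E₀)
    (hI : 0 < termCornerBound w z zb 0 0 0 slo shi)
    (hO2 : ∀ p ∈ Q, BlockPositive (pointFunctional w z zb) p.1 p.2 0)
    (hO3 : ∀ p ∈ Q, ∀ Δ : ℝ, 3 ≤ Δ → Δ < E₀ → BlockPositive (pointFunctional w z zb) p.1 Δ 0)
    (hO4 : ∀ p ∈ Q, ∀ ℓ : ℕ, Even ℓ → ℓ ≠ 0 → ∀ Δ : ℝ, (ℓ : ℝ) + 1 ≤ Δ → Δ < E₀ →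
      BlockPositive (pointFunctional w z zb) p.1 Δ ℓ)
    (hM : ∀ (j : ℕ) (E : ℝ), E₀ ≤ E → E < ET → (j : ℝ) + τ ≤ E → ∀ p ∈ Q,
      0 ≤ pointFunctional w z zb (crossF p.1 (-1) (zMono E j)))
    (hB : ∑ k ∈ univ.erase a, |w k| * ((1 - z k) * (1 - zb k)) ^ slo * qd k ^ ET
          + ∑ k, |w k| * (z k * zb k) ^ slo * qr k ^ ET ≤ w a * ((1 - z a) * (1 - zb a)) ^ shi) :
    BoxExcluded Q :=
  SingleCorrelatorObligations.boxExcluded (Δstar := E₀) hz hzb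
    { identity_pos := identity_pos_of_cornerBound w z zb hz hzb hQ hI
      epsilon_nonneg := hO2
      scalar_nonneg := hO3
      spinning_nonneg := hO4
      tail_nonneg := fun p hp ℓ _ Δ hbd hΔ0 =>
        tail_nonneg_pointFunctional_of_termwise_and_apex_twist w z zb hz hzb hord a ha qd qr hqd hqr
          hdomd hdomr hQ hτ1 hτ0 hM hB p hp ℓ Δ hbd hΔ0 }

/-! ### Head cells with rule (M) on `E - j ≥ τ` -/

/-- **Head cell from the certificate's global data (any table of term bounds), twist-gap domain.**
As `headSum_pointFunctional_of_pointRules`; the tail terms `(n, j) ∉ F` of a cell `[a, b)` with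
`a ≥ ℓ + 1` live at `E ∈ [a + n, b + n]`, so `E - j ≥ a - ℓ ≥ 1 ≥ τ`.
[cite: HogervorstRychkov2013, §3 eq. (3.9)] -/
theorem headSum_pointFunctional_of_pointRules_twist {N : ℕ} (w z zb : Fin N → ℝ)
    (hz : ∀ k, z k ∈ Ioo (0 : ℝ) 1) (hzb : ∀ k, zb k ∈ Ioo (0 : ℝ) 1) (hord : ∀ k, zb k ≤ z k)
    (apex : Fin N) (hapex : 0 ≤ w apex) (qd qr : Fin N → ℝ) (hqd : ∀ k, 0 < qd k ∧ qd k ≤ 1)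
    (hqr : ∀ k, 0 < qr k ∧ qr k ≤ 1)
    (hdomd : ∀ k, z k * zb k ≤ qd k ^ 2 * (z apex * zb apex) ∧ z k ≤ qd k * z apex)
    (hdomr : ∀ k, (1 - z k) * (1 - zb k) ≤ qr k ^ 2 * (z apex * zb apex) ∧
      1 - zb k ≤ qr k * z apex)
    {Q : Set (ℝ × ℝ)} {slo shi E₀ ET τ : ℝ} (hQ : ∀ p ∈ Q, slo ≤ p.1 ∧ p.1 ≤ shi) (hτ1 : τ ≤ 1)
    (hM : ∀ (j : ℕ) (E : ℝ), E₀ ≤ E → E < ET → (j : ℝ) + τ ≤ E → ∀ p ∈ Q,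
      0 ≤ pointFunctional w z zb (crossF p.1 (-1) (zMono E j)))
    (hB : ∑ k ∈ univ.erase apex, |w k| * ((1 - z k) * (1 - zb k)) ^ slo * qd k ^ ET
          + ∑ k, |w k| * (z k * zb k) ^ slo * qr k ^ ET ≤
          w apex * ((1 - z apex) * (1 - zb apex)) ^ shi)
    {ℓ : ℕ} {a b : ℝ} (ha : (ℓ : ℝ) + 1 ≤ a) (F : Finset (ℕ × ℕ))
    (hF : ∀ q : ℕ × ℕ, q ∉ F → InDescendantRange ℓ q.1 q.2 → E₀ ≤ a + q.1)
    (Φlo : ℕ × ℕ → ℝ)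
    (hΦ : ∀ q ∈ F, ∀ Δ ∈ Icc a b, ∀ p ∈ Q,
      Φlo q ≤ pointFunctional w z zb (crossF p.1 (-1) (zMono (Δ + (q.1 : ℝ)) q.2)))
    (hhead : 0 ≤ headCellSum ℓ a b F Φlo) :
    ∀ p ∈ Q, ∀ Δ ∈ Ico a b, BlockPositive (pointFunctional w z zb) p.1 Δ ℓ := by
  intro p hp
  refine blockPositive_pointFunctional_of_headSum_Ico w z zb hz hzb ha F Φlo
    (fun q hq Δ hΔ => hΦ q hq Δ hΔ p hp) hhead ?_
  intro q hq hr E hE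
  have h2 : (q.2 : ℝ) ≤ (ℓ : ℝ) + q.1 := by exact_mod_cast hr.2.1
  have hjb : (q.2 : ℝ) + τ ≤ E := by linarith [hE.1]
  have hE0 : E₀ ≤ E := (hF q hq hr).trans hE.1
  by_cases hET : E < ET
  · exact hM q.2 E hE0 hET hjb p hp
  · have hBs := apexIneq_of_box w z zb hz hzb apex hapex qd qr (fun k => (hqd k).1.le)
      (fun k => (hqr k).1.le) (hQ p hp) hB
    exact term_nonneg_of_apex w z zb hz hzb hord apex qd qr hqd hqr hdomd hdomr hBs
      (by linarith [hE.1]) (not_lt.1 hET)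

/-- **Head cell from the certificate's global data (corner bounds), twist-gap domain.**
[cite: HogervorstRychkov2013, §3 eq. (3.9)] -/
theorem headCell_pointFunctional_of_pointRules_twist {N : ℕ} (w z zb : Fin N → ℝ)
    (hz : ∀ k, z k ∈ Ioo (0 : ℝ) 1) (hzb : ∀ k, zb k ∈ Ioo (0 : ℝ) 1) (hord : ∀ k, zb k ≤ z k)
    (apex : Fin N) (hapex : 0 ≤ w apex) (qd qr : Fin N → ℝ) (hqd : ∀ k, 0 < qd k ∧ qd k ≤ 1)
    (hqr : ∀ k, 0 < qr k ∧ qr k ≤ 1)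
    (hdomd : ∀ k, z k * zb k ≤ qd k ^ 2 * (z apex * zb apex) ∧ z k ≤ qd k * z apex)
    (hdomr : ∀ k, (1 - z k) * (1 - zb k) ≤ qr k ^ 2 * (z apex * zb apex) ∧
      1 - zb k ≤ qr k * z apex)
    {Q : Set (ℝ × ℝ)} {slo shi E₀ ET τ : ℝ} (hQ : ∀ p ∈ Q, slo ≤ p.1 ∧ p.1 ≤ shi) (hτ1 : τ ≤ 1)
    (hM : ∀ (j : ℕ) (E : ℝ), E₀ ≤ E → E < ET → (j : ℝ) + τ ≤ E → ∀ p ∈ Q,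
      0 ≤ pointFunctional w z zb (crossF p.1 (-1) (zMono E j)))
    (hB : ∑ k ∈ univ.erase apex, |w k| * ((1 - z k) * (1 - zb k)) ^ slo * qd k ^ ET
          + ∑ k, |w k| * (z k * zb k) ^ slo * qr k ^ ET ≤
          w apex * ((1 - z apex) * (1 - zb apex)) ^ shi)
    {ℓ : ℕ} {a b : ℝ} (ha : (ℓ : ℝ) + 1 ≤ a) (F : Finset (ℕ × ℕ))
    (hF : ∀ q : ℕ × ℕ, q ∉ F → InDescendantRange ℓ q.1 q.2 → E₀ ≤ a + q.1)
    (hhead : 0 ≤ headCellBound w z zb ℓ a b slo shi F) :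
    ∀ p ∈ Q, ∀ Δ ∈ Ico a b, BlockPositive (pointFunctional w z zb) p.1 Δ ℓ :=
  headSum_pointFunctional_of_pointRules_twist w z zb hz hzb hord apex hapex qd qr hqd hqr hdomd hdomr
    hQ hτ1 hM hB ha F hF _
    (fun q _ Δ hΔ p hp => termCornerBound_le w z zb hz hzb q.2
      (⟨by linarith [hΔ.1], by linarith [hΔ.2]⟩ : Δ + (q.1 : ℝ) ∈ Icc (a + q.1) (b + q.1))
      ⟨(hQ p hp).1, (hQ p hp).2⟩)
    (by rwa [headCellBound_eq_headCellSum] at hhead)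

/-- **Chord head cell from the certificate's global data, twist-gap domain.**
[cite: HogervorstRychkov2013, §3 eq. (3.9)] -/
theorem headChord_pointFunctional_of_pointRules_twist {N : ℕ} (w z zb : Fin N → ℝ)
    (hz : ∀ k, z k ∈ Ioo (0 : ℝ) 1) (hzb : ∀ k, zb k ∈ Ioo (0 : ℝ) 1) (hord : ∀ k, zb k ≤ z k)
    (apex : Fin N) (hapex : 0 ≤ w apex) (qd qr : Fin N → ℝ) (hqd : ∀ k, 0 < qd k ∧ qd k ≤ 1)
    (hqr : ∀ k, 0 < qr k ∧ qr k ≤ 1)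
    (hdomd : ∀ k, z k * zb k ≤ qd k ^ 2 * (z apex * zb apex) ∧ z k ≤ qd k * z apex)
    (hdomr : ∀ k, (1 - z k) * (1 - zb k) ≤ qr k ^ 2 * (z apex * zb apex) ∧
      1 - zb k ≤ qr k * z apex)
    {Q : Set (ℝ × ℝ)} {slo shi E₀ ET τ : ℝ} (hQ : ∀ p ∈ Q, slo ≤ p.1 ∧ p.1 ≤ shi) (hτ1 : τ ≤ 1)
    (hM : ∀ (j : ℕ) (E : ℝ), E₀ ≤ E → E < ET → (j : ℝ) + τ ≤ E → ∀ p ∈ Q,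
      0 ≤ pointFunctional w z zb (crossF p.1 (-1) (zMono E j)))
    (hB : ∑ k ∈ univ.erase apex, |w k| * ((1 - z k) * (1 - zb k)) ^ slo * qd k ^ ET
          + ∑ k, |w k| * (z k * zb k) ^ slo * qr k ^ ET ≤
          w apex * ((1 - z apex) * (1 - zb apex)) ^ shi)
    {ℓ : ℕ} {a b : ℝ} (ha : (ℓ : ℝ) + 1 ≤ a) (F : Finset (ℕ × ℕ))
    (hF : ∀ q : ℕ × ℕ, q ∉ F → InDescendantRange ℓ q.1 q.2 → E₀ ≤ a + q.1)
    (hr : ∀ k, 1 / 2 ≤ ((1 - z k) * (1 - zb k)) ^ (shi - slo) ∧ 1 / 2 ≤ (z k * zb k) ^ (shi - slo))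
    (hρ : ∀ k, 1 / 2 ≤ (z k * zb k) ^ ((b - a) / 2) ∧ 1 / 2 ≤ ((1 - z k) * (1 - zb k)) ^ ((b - a) / 2))
    (hhead : 0 ≤ headChordBound w z zb ℓ a b slo shi F) :
    ∀ p ∈ Q, ∀ Δ ∈ Ico a b, BlockPositive (pointFunctional w z zb) p.1 Δ ℓ :=
  headSum_pointFunctional_of_pointRules_twist w z zb hz hzb hord apex hapex qd qr hqd hqr hdomd hdomr
    hQ hτ1 hM hB ha F hF _
    (fun q _ Δ hΔ p hp => by
      have hρ' : ∀ k, 1 / 2 ≤ (z k * zb k) ^ ((b + (q.1 : ℝ) - (a + q.1)) / 2) ∧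
          1 / 2 ≤ ((1 - z k) * (1 - zb k)) ^ ((b + (q.1 : ℝ) - (a + q.1)) / 2) := by
        intro k; rw [show b + (q.1 : ℝ) - (a + q.1) = b - a by ring]; exact hρ k
      exact termChordMin_le w z zb hz hzb q.2 hr hρ' ⟨(hQ p hp).1, (hQ p hp).2⟩
        (⟨by linarith [hΔ.1], by linarith [hΔ.2]⟩ : Δ + (q.1 : ℝ) ∈ Icc (a + q.1) (b + q.1)))
    hhead

/-- **One head cell from its number, twist-gap domain.** [cite: HogervorstRychkov2013, §3 eq. (3.9)] -/
theorem cell_of_headNumber_twist {N : ℕ} (w z zb : Fin N → ℝ)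
    (hz : ∀ k, z k ∈ Ioo (0 : ℝ) 1) (hzb : ∀ k, zb k ∈ Ioo (0 : ℝ) 1) (hord : ∀ k, zb k ≤ z k)
    (apex : Fin N) (hapex : 0 ≤ w apex) (qd qr : Fin N → ℝ) (hqd : ∀ k, 0 < qd k ∧ qd k ≤ 1)
    (hqr : ∀ k, 0 < qr k ∧ qr k ≤ 1)
    (hdomd : ∀ k, z k * zb k ≤ qd k ^ 2 * (z apex * zb apex) ∧ z k ≤ qd k * z apex)
    (hdomr : ∀ k, (1 - z k) * (1 - zb k) ≤ qr k ^ 2 * (z apex * zb apex) ∧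
      1 - zb k ≤ qr k * z apex)
    {Q : Set (ℝ × ℝ)} {slo shi E₀ ET τ : ℝ} (hQ : ∀ p ∈ Q, slo ≤ p.1 ∧ p.1 ≤ shi) (hτ1 : τ ≤ 1)
    (hM : ∀ (j : ℕ) (E : ℝ), E₀ ≤ E → E < ET → (j : ℝ) + τ ≤ E → ∀ p ∈ Q,
      0 ≤ pointFunctional w z zb (crossF p.1 (-1) (zMono E j)))
    (hB : ∑ k ∈ univ.erase apex, |w k| * ((1 - z k) * (1 - zb k)) ^ slo * qd k ^ ET
          + ∑ k, |w k| * (z k * zb k) ^ slo * qr k ^ ET ≤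
          w apex * ((1 - z apex) * (1 - zb apex)) ^ shi)
    (hr : ∀ k, 1 / 2 ≤ ((1 - z k) * (1 - zb k)) ^ (shi - slo) ∧ 1 / 2 ≤ (z k * zb k) ^ (shi - slo))
    {ℓ : ℕ} {a b : ℝ} (ha : (ℓ : ℝ) + 1 ≤ a) (nF : ℕ) (hnF : E₀ ≤ a + ((nF : ℝ) + 1))
    (useChord : Bool)
    (hρ : useChord = true → ∀ k, 1 / 2 ≤ (z k * zb k) ^ ((b - a) / 2) ∧
      1 / 2 ≤ ((1 - z k) * (1 - zb k)) ^ ((b - a) / 2))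
    (hnum : 0 ≤ headNumber w z zb ℓ a b slo shi nF useChord) :
    ∀ p ∈ Q, ∀ Δ ∈ Ico a b, BlockPositive (pointFunctional w z zb) p.1 Δ ℓ := by
  cases useChord with
  | true =>
    simp only [headNumber, if_true] at hnum
    exact headChord_pointFunctional_of_pointRules_twist w z zb hz hzb hord apex hapex qd qr hqd hqr
      hdomd hdomr hQ hτ1 hM hB ha (headSet ℓ nF) (headSet_off hnF) hr (hρ rfl) hnum
  | false =>
    simp only [headNumber] at hnum
    exact headCell_pointFunctional_of_pointRules_twist w z zb hz hzb hord apex hapex qd qr hqd hqr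
      hdomd hdomr hQ hτ1 hM hB ha (headSet ℓ nF) (headSet_off hnF) (by simpa using hnum)

/-! ### The finite table with rule (M) on `E - j ≥ τ` -/

/-- **(M) on the twist-gap domain from a table of boxes.** For every `j` with `j + τ < E_T` a row of
boxes `[e_{j,0}, e_{j,1}], …` with `e_{j,0} ≤ max(E₀, j + τ)`, `E_T ≤ e_{j,M_j}`, and per box a number
`boxNumber ≥ 0` (chord boxes with node ratios `≥ 1/2` for their width) give rule (M) on
`E ∈ [E₀, E_T)`, `j + τ ≤ E`. [cite: HogervorstRychkov2013, §3 eq. (3.6)] -/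
theorem ruleM_of_boxTable_twist {N : ℕ} (w z zb : Fin N → ℝ)
    (hz : ∀ k, z k ∈ Ioo (0 : ℝ) 1) (hzb : ∀ k, zb k ∈ Ioo (0 : ℝ) 1)
    {Q : Set (ℝ × ℝ)} {slo shi E₀ ET : ℝ} (τ : ℝ) (hQ : ∀ p ∈ Q, slo ≤ p.1 ∧ p.1 ≤ shi)
    (hr : ∀ k, 1 / 2 ≤ ((1 - z k) * (1 - zb k)) ^ (shi - slo) ∧ 1 / 2 ≤ (z k * zb k) ^ (shi - slo))
    (e : ℕ → ℕ → ℝ) (M : ℕ → ℕ) (bc : ℕ → ℕ → Bool)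
    (he : ∀ j : ℕ, (j : ℝ) + τ < ET → e j 0 ≤ max E₀ ((j : ℝ) + τ) ∧ ET ≤ e j (M j))
    (hρ : ∀ j m, m < M j → bc j m = true → ∀ k, 1 / 2 ≤ (z k * zb k) ^ ((e j (m + 1) - e j m) / 2) ∧
      1 / 2 ≤ ((1 - z k) * (1 - zb k)) ^ ((e j (m + 1) - e j m) / 2))
    (hbox : ∀ j : ℕ, (j : ℝ) + τ < ET → ∀ m < M j,
      0 ≤ boxNumber w z zb j (e j m) (e j (m + 1)) slo shi (bc j m)) :
    ∀ (j : ℕ) (E : ℝ), E₀ ≤ E → E < ET → (j : ℝ) + τ ≤ E → ∀ p ∈ Q,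
      0 ≤ pointFunctional w z zb (crossF p.1 (-1) (zMono E j)) := by
  intro j E hE0 hET hjE p hp
  have hjT : (j : ℝ) + τ < ET := lt_of_le_of_lt hjE hET
  obtain ⟨he0, heM⟩ := he j hjT
  have hE : E ∈ Ico (e j 0) (e j (M j)) := ⟨he0.trans (max_le hE0 hjE), lt_of_lt_of_le hET heM⟩
  obtain ⟨m, hm, hEm⟩ := exists_cell_Ico (e j) (M j) E hE
  have hnum := hbox j hjT m hm
  have hs : p.1 ∈ Icc slo shi := ⟨(hQ p hp).1, (hQ p hp).2⟩
  have hEc : E ∈ Icc (e j m) (e j (m + 1)) := ⟨hEm.1, hEm.2.le⟩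
  cases hb : bc j m with
  | true =>
    rw [hb] at hnum; simp only [boxNumber, if_true] at hnum
    exact termwise_nonneg_of_chordMin w z zb hz hzb j hr (hρ j m hm hb) hnum E hEc p.1 hs
  | false =>
    rw [hb] at hnum; simp only [boxNumber] at hnum
    exact termwise_nonneg_of_cornerBound w z zb hz hzb j (by simpa using hnum) E hEc p.1 hs

/-- **The point-functional certificate as a finite table, twist-gap domain.** As
`boxExcluded_of_pointTable` with a twist-gap parameter `τ ≤ 1`, `τ ≤ E₀`: the (M) box rows are
required for `j + τ < E_T` only, each from `≤ max(E₀, j + τ)` to `≥ E_T` (`τ = 1`: the domain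
`j ≤ E - 1` of the production verifier, pub-ising3d REFEREE F58; `τ = 1/2`: the landed table).
[cite: HogervorstRychkov2013, §3 eq. (3.6)] -/
theorem boxExcluded_of_pointTable_twist {N : ℕ} {w z zb : Fin N → ℝ}
    (hz : ∀ k, z k ∈ Ioo (0 : ℝ) 1) (hzb : ∀ k, zb k ∈ Ioo (0 : ℝ) 1) (hord : ∀ k, zb k ≤ z k)
    (apex : Fin N) (hapex : 0 ≤ w apex) (qd qr : Fin N → ℝ) (hqd : ∀ k, 0 < qd k ∧ qd k ≤ 1)
    (hqr : ∀ k, 0 < qr k ∧ qr k ≤ 1)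
    (hdomd : ∀ k, z k * zb k ≤ qd k ^ 2 * (z apex * zb apex) ∧ z k ≤ qd k * z apex)
    (hdomr : ∀ k, (1 - z k) * (1 - zb k) ≤ qr k ^ 2 * (z apex * zb apex) ∧
      1 - zb k ≤ qr k * z apex)
    {Q : Set (ℝ × ℝ)} {slo shi εlo E₀ ET τ : ℝ}
    (hQ : ∀ p ∈ Q, (slo ≤ p.1 ∧ p.1 ≤ shi) ∧ (εlo ≤ p.2 ∧ p.2 < E₀))
    (hε3 : εlo ≤ 3) (L : ℕ) (hL : E₀ ≤ (L : ℝ) + 1) (hτ1 : τ ≤ 1) (hτ0 : τ ≤ E₀)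
    (hr : ∀ k, 1 / 2 ≤ ((1 - z k) * (1 - zb k)) ^ (shi - slo) ∧ 1 / 2 ≤ (z k * zb k) ^ (shi - slo))
    -- (O1)
    (hI : 0 < termCornerBound w z zb 0 0 0 slo shi)
    -- head rows
    (t : ℕ → ℕ → ℝ) (K : ℕ → ℕ) (nF : ℕ → ℕ → ℕ) (hc : ℕ → ℕ → Bool)
    (ht0 : t 0 0 = εlo ∧ t 0 (K 0) = E₀)
    (htℓ : ∀ ℓ, Even ℓ → ℓ ≠ 0 → ℓ < L → t ℓ 0 = (ℓ : ℝ) + 1 ∧ t ℓ (K ℓ) = E₀)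
    (hlow : ∀ ℓ k, k < K ℓ → (ℓ : ℝ) + 1 ≤ t ℓ k)
    (hnF : ∀ ℓ k, k < K ℓ → E₀ ≤ t ℓ k + ((nF ℓ k : ℝ) + 1))
    (hρ : ∀ ℓ k, k < K ℓ → hc ℓ k = true → ∀ i, 1 / 2 ≤ (z i * zb i) ^ ((t ℓ (k + 1) - t ℓ k) / 2) ∧
      1 / 2 ≤ ((1 - z i) * (1 - zb i)) ^ ((t ℓ (k + 1) - t ℓ k) / 2))
    (hhead : ∀ ℓ, (ℓ = 0 ∨ (Even ℓ ∧ ℓ < L)) → ∀ k < K ℓ,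
      0 ≤ headNumber w z zb ℓ (t ℓ k) (t ℓ (k + 1)) slo shi (nF ℓ k) (hc ℓ k))
    -- (M) box rows
    (e : ℕ → ℕ → ℝ) (M : ℕ → ℕ) (bc : ℕ → ℕ → Bool)
    (he : ∀ j : ℕ, (j : ℝ) + τ < ET → e j 0 ≤ max E₀ ((j : ℝ) + τ) ∧ ET ≤ e j (M j))
    (hρM : ∀ j m, m < M j → bc j m = true → ∀ k, 1 / 2 ≤ (z k * zb k) ^ ((e j (m + 1) - e j m) / 2) ∧
      1 / 2 ≤ ((1 - z k) * (1 - zb k)) ^ ((e j (m + 1) - e j m) / 2))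
    (hbox : ∀ j : ℕ, (j : ℝ) + τ < ET → ∀ m < M j,
      0 ≤ boxNumber w z zb j (e j m) (e j (m + 1)) slo shi (bc j m))
    -- (T)
    (hB : ∑ k ∈ univ.erase apex, |w k| * ((1 - z k) * (1 - zb k)) ^ slo * qd k ^ ET
          + ∑ k, |w k| * (z k * zb k) ^ slo * qr k ^ ET ≤
          w apex * ((1 - z apex) * (1 - zb apex)) ^ shi) :
    BoxExcluded Q := by
  have hQ1 : ∀ p ∈ Q, slo ≤ p.1 ∧ p.1 ≤ shi := fun p hp => (hQ p hp).1
  have hM := ruleM_of_boxTable_twist w z zb hz hzb τ hQ1 hr e M bc he hρM hbox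
  -- every cell of every row
  have hcell : ∀ ℓ, (ℓ = 0 ∨ (Even ℓ ∧ ℓ < L)) → ∀ k < K ℓ, ∀ p ∈ Q,
      ∀ Δ ∈ Ico (t ℓ k) (t ℓ (k + 1)), BlockPositive (pointFunctional w z zb) p.1 Δ ℓ :=
    fun ℓ hℓ k hk => cell_of_headNumber_twist w z zb hz hzb hord apex hapex qd qr hqd hqr hdomd hdomr
      hQ1 hτ1 hM hB hr (hlow ℓ k hk) (nF ℓ k) (hnF ℓ k hk) (hc ℓ k) (hρ ℓ k hk) (hhead ℓ hℓ k hk)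
  refine boxExcluded_of_pointRules_twist hz hzb hord apex hapex qd qr hqd hqr hdomd hdomr hQ1 hτ1 hτ0
    hI ?_ ?_ ?_ hM hB
  · -- (O2)
    exact epsilon_nonneg_of_cells (t 0) (K 0)
      (fun p hp => ⟨ht0.1 ▸ (hQ p hp).2.1, ht0.2 ▸ (hQ p hp).2.2⟩) (hcell 0 (Or.inl rfl))
  · -- (O3)
    exact scalar_nonneg_of_cells (t 0) (K 0) (ht0.1 ▸ hε3) ht0.2 (hcell 0 (Or.inl rfl))
  · -- (O4)
    exact spinning_nonneg_of_cells L hL t K (fun ℓ hev hℓ hℓL => (htℓ ℓ hev hℓ hℓL).1.le)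
      (fun ℓ hev hℓ hℓL => (htℓ ℓ hev hℓ hℓL).2)
      (fun ℓ hev hℓ hℓL => hcell ℓ (Or.inr ⟨hev, hℓL⟩))

/-- The landed rule-(M) hypothesis (domain `j + 1/2 ≤ E`) implies the twist-gap one for every
`τ ≥ 1/2`: certificates checked on the larger domain instantiate the `τ`-theorems too. [folklore] -/
theorem ruleM_twist_of_ruleM_half {N : ℕ} {w z zb : Fin N → ℝ} {Q : Set (ℝ × ℝ)} {E₀ ET τ : ℝ}
    (hτ : 1 / 2 ≤ τ)
    (hM : ∀ (j : ℕ) (E : ℝ), E₀ ≤ E → E < ET → (j : ℝ) + 1 / 2 ≤ E → ∀ p ∈ Q,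
      0 ≤ pointFunctional w z zb (crossF p.1 (-1) (zMono E j))) :
    ∀ (j : ℕ) (E : ℝ), E₀ ≤ E → E < ET → (j : ℝ) + τ ≤ E → ∀ p ∈ Q,
      0 ≤ pointFunctional w z zb (crossF p.1 (-1) (zMono E j)) :=
  fun j E h0 hT hj p hp => hM j E h0 hT (by linarith) p hp

end Literature.MathematicalPhysics.QuantumFieldTheory.ConformalBootstrap3D
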